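import Summits.RiemannHypothesis.RiemannHypothesis.Theses.SignCone
import Summits.RiemannHypothesis.RiemannHypothesis.Theorems.SignConeEnvelopeCutoff

/-!
# Strategist r1 — the VARIATIONAL / KKT split of `SignConeOscillatory` (typed, assembly kernel-checked, NOT adopted)
(crux stmt-RiemannHypothesis-16302, route `SignCone`; unit `cstrat-stmt-RiemannHypothesis-16302-r1`, 2026-08-17)

This file is EVIDENCE for `STRATEGY-CENSUS.md` §Decomposition, candidate D5 ("extremal existence + positivity
remainder", the coordinator's seed). It types the two pieces and proves the assembly sorry-free:

* `VariationalAttainment` (E) — at every cutoff `a` the unit-slack extremal problem has a TIGHT primal–dual triple: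
  a level `λ`, a non-negative fake weight `c` with the fake explicit formula `L − λ·Re F(0) − P_c ≥ 0` on every smooth
  family at cutoff `a` (dual feasibility), and an energy-class extremal family `g*` in the sign cone with
  `Re F*(0) = 1`, `L(F*) − λ − P_c(F*) = 0` (tightness) and `c(n)·Re F*(log n) = 0` (complementary slackness).
  TRUE by trace-class compactness + Bauer's maximum principle + finite-dimensional conic duality with a Slater point
  (the proved `SignConeDuality` shifted by `λ`) + density of smooth families in the energy class; provable, size L.
* `TightCertificatesNonneg` (P) — every tight triple has `λ ≥ 0`.
* `signConeOscillatory_of_variational : E → P → SignConeOscillatory` — the assembly (≈ 25 lines, no `sorry`).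

VERDICT (census): rejected as a BC2 redirect IN SPIRIT although it passes (a), (b) and the cheap probes of (c):
by tightness and slackness `λ = L(F*)`, so P reads "the minimum value of the SAME functional is ≥ 0, evaluated at the
argmin" — the crux relabelled on its extremisers (`decomposition-first` failure mode "hard Sub = X in costume");
no mechanism exploiting tightness is known (2001 NF/pinning rows, Bombieri 2000/2003 variational analysis).
-/

noncomputable section

set_option linter.dupNamespace false

open scoped BigOperators ComplexConjugate
open Complex MeasureTheory Set Filter

namespace Summit.RiemannHypothesis.RiemannHypothesis.Cruxes.SignConeOscillatory.StrategistR1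

open Literature.NumberTheory.LFunctions
open Summit.RiemannHypothesis.RiemannHypothesis.Theses.SignCone
open Summit.RiemannHypothesis.RiemannHypothesis.Theorems.SignCone

/-- The autocorrelation sum `F = Σᵢ gᵢ ⋆ g̃ᵢ` of a finite family. [folklore] -/
def acSum {k : ℕ} (g : Fin k → ℝ → ℂ) : ℝ → ℂ :=
  fun t => ∑ i, weilConv (g i) (weilReflect (g i)) t

/-- The unit-slack functional `L(F) := Re W_ar(F) + Re F(0)`, `W_ar = weilPolarTerm + weilArchTerm`. [folklore] -/
def slackL (F : ℝ → ℂ) : ℝ :=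
  (weilPolarTerm F + weilArchTerm F).re + (F 0).re

/-- The finite fake prime sum `P_c^N(F) := Σ_{2 ≤ n ≤ N} (c n/√n)·2 Re F(log n)`. [folklore] -/
def fakeP (N : ℕ) (c : ℕ → ℝ) (F : ℝ → ℂ) : ℝ :=
  ∑ n ∈ Finset.Icc 2 N, c n / Real.sqrt n * (2 * (F (Real.log n)).re)

/-- Smooth (Weil-test) family supported in `[-a, a]`. [folklore] -/
def IsSmoothFamily (a : ℝ) {k : ℕ} (g : Fin k → ℝ → ℂ) : Prop :=
  ∀ i, IsWeilTest (g i) ∧ tsupport (g i) ⊆ Set.Icc (-a) a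

/-- Energy-class family at cutoff `a`: square-integrable, vanishing off `[-a, a]`, finite logarithmic spectral moment
(the closure class in which the extremal problem is attained; smooth families are energy families). [folklore] -/
def IsEnergyFamily (a : ℝ) {k : ℕ} (g : Fin k → ℝ → ℂ) : Prop :=
  ∀ i, MemLp (g i) 2 volume ∧ (∀ t, t ∉ Set.Icc (-a) a → g i t = 0) ∧
    Integrable (fun y : ℝ => ‖weilMellin (g i) (1 / 2 + y * I)‖ ^ 2 * Real.log (2 + |y|)) volume

/-- DUAL FEASIBILITY of the fake explicit formula `(c, λ)` at cutoff `a`, node range `N`: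
`L(F) − λ·Re F(0) − P_c^N(F) ≥ 0` for every smooth family at cutoff `a`
(for `λ = 0` and `N ≥ e^{2a}` this is "c ∈ K♭_a", the antecedent of `ConeMagnification` at `a`, summed over `i`). [folklore] -/
def DualFeasible (a : ℝ) (N : ℕ) (c : ℕ → ℝ) (lam : ℝ) : Prop :=
  ∀ (k : ℕ) (g : Fin k → ℝ → ℂ), IsSmoothFamily a g →
    0 ≤ slackL (acSum g) - lam * (acSum g 0).re - fakeP N c (acSum g)

/-- A TIGHT KKT TRIPLE `(c, λ, g*)` at cutoff `a`: `c ≥ 0` dual feasible at level `λ`; `g*` an energy family in the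
sign cone, normalised `Re F*(0) = 1`, on which the fake explicit formula is TIGHT and complementary slackness holds. [folklore] -/
def IsTightTriple (a : ℝ) (N : ℕ) (c : ℕ → ℝ) (lam : ℝ) {k : ℕ} (g : Fin k → ℝ → ℂ) : Prop :=
  (∀ n, 0 ≤ c n) ∧ DualFeasible a N c lam ∧ IsEnergyFamily a g ∧
    (∀ n : ℕ, 2 ≤ n → 0 ≤ (acSum g (Real.log n)).re) ∧ (acSum g 0).re = 1 ∧
    slackL (acSum g) - lam - fakeP N c (acSum g) = 0 ∧
    ∀ n ∈ Finset.Icc 2 N, c n * (acSum g (Real.log n)).re = 0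

/-- PIECE E — `VariationalAttainment`: at every cutoff the unit-slack extremal problem on the sign cone has a tight
KKT triple (primal attainment in the energy class + dual attainment + strong duality). [folklore] -/
def VariationalAttainment : Prop :=
  ∀ a : ℝ, 0 < a → ∃ (N : ℕ) (c : ℕ → ℝ) (lam : ℝ) (k : ℕ) (g : Fin k → ℝ → ℂ),
    Real.exp (2 * a) ≤ N ∧ IsTightTriple a N c lam g

/-- PIECE P — `TightCertificatesNonneg`: every tight fake explicit formula at a finite cutoff has non-negative level. [folklore] -/
def TightCertificatesNonneg : Prop :=
  ∀ a : ℝ, 0 < a → ∀ (N : ℕ) (c : ℕ → ℝ) (lam : ℝ) (k : ℕ) (g : Fin k → ℝ → ℂ),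
    Real.exp (2 * a) ≤ N → IsTightTriple a N c lam g → 0 ≤ lam

/-- On the sign cone the finite fake prime sum of a non-negative weight is non-negative. [folklore] -/
theorem fakeP_nonneg {N : ℕ} {c : ℕ → ℝ} (hc : ∀ n, 0 ≤ c n) {F : ℝ → ℂ}
    (hn : ∀ n : ℕ, 2 ≤ n → 0 ≤ (F (Real.log n)).re) : 0 ≤ fakeP N c F := by
  unfold fakeP
  refine Finset.sum_nonneg fun n hn' => ?_
  have h2 : 2 ≤ n := (Finset.mem_Icc.1 hn').1
  have := hn n h2
  have hcn := hc n
  positivity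

/-- **ASSEMBLY (kernel-checked): E → P → `SignConeOscillatory`.** Given a node-nonnegative smooth family at cutoff
`a`, E supplies a tight triple `(c, λ, g*)`, P gives `λ ≥ 0`, dual feasibility of `(c, λ)` tested on the GIVEN family
gives `L(F) ≥ λ·Re F(0) + P_c(F) ≥ 0`, i.e. `-Re F(0) ≤ Re W_ar(F)` (the item's `M`-form is definitionally the
Literature form, route CONE NOTE rev 3). [folklore] -/
theorem signConeOscillatory_of_variational (hE : VariationalAttainment) (hP : TightCertificatesNonneg) :
    SignConeOscillatory := by
  intro a ha k g hg F hn _hosc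
  show -(F 0).re ≤ (weilPolarTerm F + weilArchTerm F).re
  obtain ⟨N, c, lam, k', g', hN, hT⟩ := hE a ha
  have hlam : 0 ≤ lam := hP a ha N c lam k' g' hN hT
  obtain ⟨hc, hdual, -, -, -, -, -⟩ := hT
  have hF : acSum g = F := rfl
  have hfeas := hdual k g (fun i => ⟨(hg i).1, (hg i).2⟩)
  rw [hF] at hfeas
  have hP0 : 0 ≤ fakeP N c F := fakeP_nonneg hc hn
  have h0 : 0 ≤ (F 0).re := re_apply_zero_nonneg (g := g) (F := F) rfl
  have hlam0 : 0 ≤ lam * (F 0).re := mul_nonneg hlam h0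
  unfold slackL at hfeas
  linarith

end Summit.RiemannHypothesis.RiemannHypothesis.Cruxes.SignConeOscillatory.StrategistR1

end
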